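/-
Copyright (c) 2026 the pub-hodgecm-mathlib formalisation cell (harness21).  Prover seat hodgecm-mathlib-K2E5-p16 (g4): Track B «K2-LIT»,
hLiu418 = stmt-HodgeConjecture-24832, ROAD Φ organ Φ6b-3 step (Y3a) (dealer K2E5-plan (g5) GO 2026-09-04T06:21:58Z «ξ–η identity»): FOURIER
INVERSION of the Gamma kernel on `Herm₂(ℂ)` — `∫ e^{−iτ(wx)} det(g − ix)^{−s} dx = 4π⁴ Γ₂(s)⁻¹ φ_s(w)`; 2026-09-04.
-/
import Summits.HodgeConjecture.HodgeConjecture.Theorems.K2LiuHermTwoGammaKernelFourier        -- ★ (this seat): the kernel and its pairing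
import Summits.HodgeConjecture.HodgeConjecture.Theorems.K2LiuHermTwoChartLp                    -- ★ (this seat): Hilbert-space model, COV
import Summits.HodgeConjecture.HodgeConjecture.Theorems.K2LiuHermTwoConfluentXiConvergence      -- ★ (this seat): `norm_cpow_neg_le`
import Mathlib.Analysis.Fourier.Inversion
import HarnessLib

/-!
# Crux `HLiu418`, ROAD Φ, organ Φ6b-3 (Y3a): Fourier inversion of the Gamma kernel on `Herm₂(ℂ)`
# `∫_{Herm₂(ℂ)} e^{−i τ(w x)} det(g − ix)^{−s} dx = 4π⁴ · Γ₂(s)⁻¹ · e^{−τ(w g)} det(w)^{s−2}`  (`g, w > 0`, `re s > 3`)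

Cell `hodgecm-mathlib`, crux item hLiu418 = `stmt-HodgeConjecture-24832`, route of record `HCCMUnconditional`; squad K2, LEAD F0P6-plan (g12), co-dealer
K2E5-plan (g5), prover K2E5-p16 (g4).  THEOREMS ONLY (no `def`, no instance, no notation, no named-fact hypothesis, no `sorry`, default heartbeats);
lane `--supports stmt-HodgeConjecture-24832 --as helper`.

WHAT IS PROVED.  With `W = WithLp 2 (ℝ × WithLp 2 (ℂ × ℝ))`, `ι c = toLp 2 (c.1, toLp 2 c.2)`, `κ y = ((ofLp y).1, ofLp (ofLp y).2)`, `dbl c = (a, 2z, b)`,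
`φ_s` = the Gamma kernel of ★ `K2LiuHermTwoGammaKernelFourier` and `f̃ = φ_s ∘ κ : W → ℂ`:
* `inner_toLp2_dbl` — `⟪ι v, ι (dbl c)⟫ = τ_ℝ(v, c)` (the real trace pairing);
* `fourierInv_kernel_at` ∕ `fourier_kernel_at` — Mathlib's `𝓕⁻ f̃` ∕ `𝓕 f̃` at the point `(2π)⁻¹ • ι(dbl c)` ARE the trace-pairing transforms:
  `Γ₂(s) det(g ∓ ix_c)^{−s}` (★ tube formulas);
* `integrable_fourier_kernel` — `𝓕 f̃ ∈ L¹(W)` for `re s > 3` (★ majorant `integrable_norm_det_add_I_smul_rpow_neg` through the three changes of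
  variables ★ `integrable_comp_dblZ_iff`, ★ `integrable_comp_toLp2_iff`, ★ `integrable_comp_smul_iff`);
* `integral_cexp_trace_mul_det_cpow` — THE INVERSION FORMULA above, for `w` in the open cone (★ `MeasureTheory.Integrable.fourier_fourierInv_eq`
  at `ι w`, continuity ★ `continuousAt_gammaKernel_of_posDef`, and the constant `(2π)⁴/4 = 4π⁴` from the changes of variables).
NEXT (Y3b): the ξ–η identity `ξ(g,h;α,β) = 4π⁴ e^{iπ(β−α)} Γ₂(α)⁻¹Γ₂(β)⁻¹ η(2g, πh; α, β)` for `g, h > 0`.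
HONEST LABEL.  Count-neutral helper of the K2_Liu road; it pays no socket by itself: `HC_CM` is proved only modulo the 7 printed citations
(2 remaining named inputs: hLiu418 = `stmt-HodgeConjecture-24832`, h413 = `stmt-HodgeConjecture-24833`) until rung 0 closes.
-/

set_option autoImplicit false
-- the mandated namespace repeats the single-problem summit's segment (`HodgeConjecture.HodgeConjecture`)
set_option linter.dupNamespace false

noncomputable section

open Complex MeasureTheory Set WithLp
open scoped ComplexOrder ComplexConjugate RealInnerProductSpace FourierTransform

namespace Summit.HodgeConjecture.HodgeConjecture.Cruxes.HLiu418.K2LiuHermTwoGammaKernelInversion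

open Summit.HodgeConjecture.HodgeConjecture.Cruxes.HLiu418.K2LiuHermTwoGammaDefs
open Summit.HodgeConjecture.HodgeConjecture.Cruxes.HLiu418.K2LiuHermTwoGammaSiegelGindikin
open Summit.HodgeConjecture.HodgeConjecture.Cruxes.HLiu418.K2LiuHermTwoGammaKernelFourier
open Summit.HodgeConjecture.HodgeConjecture.Cruxes.HLiu418.K2LiuHermTwoChartLp
open Summit.HodgeConjecture.HodgeConjecture.Cruxes.HLiu418.K2LiuHermTwoDetPowerIntegrable
open Summit.HodgeConjecture.HodgeConjecture.Cruxes.HLiu418.K2LiuHermTwoConfluentXiDefs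
open Summit.HodgeConjecture.HodgeConjecture.Cruxes.HLiu418.K2LiuHermTwoConfluentXiConvergence

/-! ## The real trace pairing as the inner product -/

/-- `⟪ι v, ι (dbl c)⟫ = a_v a_c + b_v b_c + 2 re(z_v z̄_c)` (β-unreduced form of `ι (dbl c)`). -/
theorem inner_toLp2_dbl (v c : ℝ × ℂ × ℝ) :
    ⟪(toLp 2 (v.1, toLp 2 v.2) : WithLp 2 (ℝ × WithLp 2 (ℂ × ℝ))),
        toLp 2 ((c.1, (2 : ℝ) • c.2.1, c.2.2).1, toLp 2 (c.1, (2 : ℝ) • c.2.1, c.2.2).2)⟫ =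
      v.1 * c.1 + v.2.2 * c.2.2 + 2 * (v.2.1 * conj c.2.1).re := by
  have h := trace_hermTwo_eq_inner_dbl v c
  rw [trace_hermTwo_mul_hermTwo] at h
  exact_mod_cast h.symm

/-- The same in projection-reduced form. -/
theorem inner_toLp2_dbl_red (v c : ℝ × ℂ × ℝ) :
    ⟪(toLp 2 (v.1, toLp 2 v.2) : WithLp 2 (ℝ × WithLp 2 (ℂ × ℝ))), toLp 2 (c.1, toLp 2 ((2 : ℝ) • c.2.1, c.2.2))⟫ =
      v.1 * c.1 + v.2.2 * c.2.2 + 2 * (v.2.1 * conj c.2.1).re :=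
  inner_toLp2_dbl v c

/-- `κ (ι c) = c`. -/
theorem ofLp2_toLp2 (c : ℝ × ℂ × ℝ) :
    ((ofLp (toLp 2 (c.1, toLp 2 c.2) : WithLp 2 (ℝ × WithLp 2 (ℂ × ℝ)))).1,
      ofLp (ofLp (toLp 2 (c.1, toLp 2 c.2) : WithLp 2 (ℝ × WithLp 2 (ℂ × ℝ)))).2) = c := by
  simp

/-- `κ` is continuous. -/
theorem continuous_ofLp2 :
    Continuous (fun y : WithLp 2 (ℝ × WithLp 2 (ℂ × ℝ)) => (((ofLp y).1, ofLp (ofLp y).2) : ℝ × ℂ × ℝ)) := by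
  have h1 : Continuous (@ofLp 2 (ℝ × WithLp 2 (ℂ × ℝ))) := WithLp.prod_continuous_ofLp 2 ℝ (WithLp 2 (ℂ × ℝ))
  have h2 : Continuous (@ofLp 2 (ℂ × ℝ)) := WithLp.prod_continuous_ofLp 2 ℂ ℝ
  exact (continuous_fst.comp h1).prodMk (h2.comp (continuous_snd.comp h1))

/-! ## `𝓕⁻ f̃` and `𝓕 f̃` at the points `(2π)⁻¹ • ι(dbl c)` -/

/-- `𝓕⁻ f̃ ((2π)⁻¹ ι(dbl c)) = ∫ φ_s(v) e^{+iτ(v,c)} dv = Γ₂(s) det(g − ix_c)^{−s}`. -/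
theorem fourierInv_kernel_at {g : Matrix (Fin 2) (Fin 2) ℂ} (hg : g.PosDef) {s : ℂ} (hs : 1 < s.re) (c : ℝ × ℂ × ℝ) :
    𝓕⁻ (fun y : WithLp 2 (ℝ × WithLp 2 (ℂ × ℝ)) => {x : ℝ × ℂ × ℝ | (hermTwo x).PosDef}.indicator (fun x => cexp (-(hermTwo x * g).trace) * (hermTwo x).det ^ (s - 2)) ((ofLp y).1, ofLp (ofLp y).2)) (((1 / (2 * Real.pi) : ℝ)) • (toLp 2 ((c.1, (2 : ℝ) • c.2.1, c.2.2).1, toLp 2 (c.1, (2 : ℝ) • c.2.1, c.2.2).2) : WithLp 2 (ℝ × WithLp 2 (ℂ × ℝ)))) = hermTwoGamma s * (g - I • hermTwo c).det ^ (-s) := by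
  rw [Real.fourierInv_eq', ← integral_gammaKernel_mul_cexp_trace_neg hg hs c,
    ← integral_comp_toLp2 (fun y : WithLp 2 (ℝ × WithLp 2 (ℂ × ℝ)) => cexp (↑(2 * Real.pi * ⟪y, ((1 / (2 * Real.pi) : ℝ)) • (toLp 2 ((c.1, (2 : ℝ) • c.2.1, c.2.2).1, toLp 2 (c.1, (2 : ℝ) • c.2.1, c.2.2).2) : WithLp 2 (ℝ × WithLp 2 (ℂ × ℝ)))⟫) * I) •
      {x : ℝ × ℂ × ℝ | (hermTwo x).PosDef}.indicator (fun x => cexp (-(hermTwo x * g).trace) * (hermTwo x).det ^ (s - 2)) ((ofLp y).1, ofLp (ofLp y).2))]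
  refine integral_congr_ae (Filter.Eventually.of_forall fun v => ?_)
  have hπ0 : (Real.pi : ℂ) ≠ 0 := ofReal_ne_zero.mpr Real.pi_ne_zero
  simp only [real_inner_smul_right, inner_toLp2_dbl_red, trace_hermTwo_mul_hermTwo, smul_eq_mul]
  rw [mul_comm]
  congr 1
  congr 1
  push_cast
  field_simp

/-- `𝓕 f̃ ((2π)⁻¹ ι(dbl c)) = ∫ φ_s(v) e^{−iτ(v,c)} dv = Γ₂(s) det(g + ix_c)^{−s}`. -/
theorem fourier_kernel_at {g : Matrix (Fin 2) (Fin 2) ℂ} (hg : g.PosDef) {s : ℂ} (hs : 1 < s.re) (c : ℝ × ℂ × ℝ) :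
    𝓕 (fun y : WithLp 2 (ℝ × WithLp 2 (ℂ × ℝ)) => {x : ℝ × ℂ × ℝ | (hermTwo x).PosDef}.indicator (fun x => cexp (-(hermTwo x * g).trace) * (hermTwo x).det ^ (s - 2)) ((ofLp y).1, ofLp (ofLp y).2)) (((1 / (2 * Real.pi) : ℝ)) • (toLp 2 ((c.1, (2 : ℝ) • c.2.1, c.2.2).1, toLp 2 (c.1, (2 : ℝ) • c.2.1, c.2.2).2) : WithLp 2 (ℝ × WithLp 2 (ℂ × ℝ)))) = hermTwoGamma s * (g + I • hermTwo c).det ^ (-s) := by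
  rw [Real.fourier_eq', ← integral_gammaKernel_mul_cexp_trace hg hs c,
    ← integral_comp_toLp2 (fun y : WithLp 2 (ℝ × WithLp 2 (ℂ × ℝ)) => cexp (↑(-2 * Real.pi * ⟪y, ((1 / (2 * Real.pi) : ℝ)) • (toLp 2 ((c.1, (2 : ℝ) • c.2.1, c.2.2).1, toLp 2 (c.1, (2 : ℝ) • c.2.1, c.2.2).2) : WithLp 2 (ℝ × WithLp 2 (ℂ × ℝ)))⟫) * I) •
      {x : ℝ × ℂ × ℝ | (hermTwo x).PosDef}.indicator (fun x => cexp (-(hermTwo x * g).trace) * (hermTwo x).det ^ (s - 2)) ((ofLp y).1, ofLp (ofLp y).2))]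
  refine integral_congr_ae (Filter.Eventually.of_forall fun v => ?_)
  have hπ0 : (Real.pi : ℂ) ≠ 0 := ofReal_ne_zero.mpr Real.pi_ne_zero
  simp only [real_inner_smul_right, inner_toLp2_dbl_red, trace_hermTwo_mul_hermTwo, smul_eq_mul]
  rw [mul_comm]
  congr 1
  congr 1
  push_cast
  field_simp

/-! ## Integrability of `𝓕 f̃` (`re s > 3`) -/

/-- The closed form `c ↦ Γ₂(s) det(g + ix_c)^{−s}` is integrable on the chart for `re s > 3`. -/
theorem integrable_hermTwoGamma_mul_det_cpow {g : Matrix (Fin 2) (Fin 2) ℂ} (hg : g.PosDef) {s : ℂ} (hs : 3 < s.re) :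
    Integrable (fun c : ℝ × ℂ × ℝ => hermTwoGamma s * (g + I • hermTwo c).det ^ (-s)) := by
  refine Integrable.const_mul ?_ _
  refine ((integrable_norm_det_add_I_smul_rpow_neg hg hs).const_mul (Real.exp (Real.pi * |s.im|))).mono' ?_ ?_
  · exact ((continuous_det_add_I_smul_hermTwo g).measurable.pow_const _).aestronglyMeasurable
  · refine Filter.Eventually.of_forall fun c => ?_
    exact norm_cpow_neg_le (norm_pos_iff.mp (norm_det_add_I_smul_pos hg c)) s

/-- `f̃ ∈ L¹(W)`. -/
theorem integrable_kernel_lp2 {g : Matrix (Fin 2) (Fin 2) ℂ} (hg : g.PosDef) {s : ℂ} (hs : 1 < s.re) :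
    Integrable (fun y : WithLp 2 (ℝ × WithLp 2 (ℂ × ℝ)) => {x : ℝ × ℂ × ℝ | (hermTwo x).PosDef}.indicator (fun x => cexp (-(hermTwo x * g).trace) * (hermTwo x).det ^ (s - 2)) ((ofLp y).1, ofLp (ofLp y).2)) :=
  (integrable_comp_toLp2_iff _).mp (by simpa only [WithLp.ofLp_toLp] using integrable_gammaKernel hg hs)

/-- `𝓕 f̃` is continuous (Fourier transform of an `L¹` function). -/
theorem continuous_fourier_kernel {g : Matrix (Fin 2) (Fin 2) ℂ} (hg : g.PosDef) {s : ℂ} (hs : 1 < s.re) :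
    Continuous (𝓕 (fun y : WithLp 2 (ℝ × WithLp 2 (ℂ × ℝ)) => {x : ℝ × ℂ × ℝ | (hermTwo x).PosDef}.indicator (fun x => cexp (-(hermTwo x * g).trace) * (hermTwo x).det ^ (s - 2)) ((ofLp y).1, ofLp (ofLp y).2))) :=
  VectorFourier.fourierIntegral_continuous Real.continuous_fourierChar (innerSL ℝ).continuous₂ (integrable_kernel_lp2 hg hs)

/-- `𝓕⁻ f̃` is continuous. -/
theorem continuous_fourierInv_kernel {g : Matrix (Fin 2) (Fin 2) ℂ} (hg : g.PosDef) {s : ℂ} (hs : 1 < s.re) :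
    Continuous (𝓕⁻ (fun y : WithLp 2 (ℝ × WithLp 2 (ℂ × ℝ)) => {x : ℝ × ℂ × ℝ | (hermTwo x).PosDef}.indicator (fun x => cexp (-(hermTwo x * g).trace) * (hermTwo x).det ^ (s - 2)) ((ofLp y).1, ofLp (ofLp y).2))) := by
  have h : 𝓕⁻ (fun y : WithLp 2 (ℝ × WithLp 2 (ℂ × ℝ)) => {x : ℝ × ℂ × ℝ | (hermTwo x).PosDef}.indicator (fun x => cexp (-(hermTwo x * g).trace) * (hermTwo x).det ^ (s - 2)) ((ofLp y).1, ofLp (ofLp y).2)) = fun w => 𝓕 (fun y : WithLp 2 (ℝ × WithLp 2 (ℂ × ℝ)) => {x : ℝ × ℂ × ℝ | (hermTwo x).PosDef}.indicator (fun x => cexp (-(hermTwo x * g).trace) * (hermTwo x).det ^ (s - 2)) ((ofLp y).1, ofLp (ofLp y).2)) (-w) := funext fun w => Real.fourierInv_eq_fourier_neg _ w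
  rw [h]
  exact (continuous_fourier_kernel hg hs).comp continuous_neg

set_option maxHeartbeats 400000 in
-- the three changes of variables make the unifier work on large `WithLp` terms
/-- `𝓕 f̃ ∈ L¹(W)` for `re s > 3`. -/
theorem integrable_fourier_kernel {g : Matrix (Fin 2) (Fin 2) ℂ} (hg : g.PosDef) {s : ℂ} (hs : 3 < s.re) :
    Integrable (𝓕 (fun y : WithLp 2 (ℝ × WithLp 2 (ℂ × ℝ)) => {x : ℝ × ℂ × ℝ | (hermTwo x).PosDef}.indicator (fun x => cexp (-(hermTwo x * g).trace) * (hermTwo x).det ^ (s - 2)) ((ofLp y).1, ofLp (ofLp y).2))) := by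
  have hs1 : 1 < s.re := by linarith
  have hHc := continuous_fourier_kernel hg hs1
  have hπ : (1 / (2 * Real.pi) : ℝ) ≠ 0 := by positivity
  have hιm : Measurable (fun c : ℝ × ℂ × ℝ => (toLp 2 (c.1, toLp 2 c.2) : WithLp 2 (ℝ × WithLp 2 (ℂ × ℝ)))) := measurableEmbedding_toLp2.measurable
  -- the composite `c ↦ 𝓕 f̃ ((2π)⁻¹ • ι(dbl c))` is the closed form, hence integrable
  have h3 : Integrable (fun c : ℝ × ℂ × ℝ => 𝓕 (fun y : WithLp 2 (ℝ × WithLp 2 (ℂ × ℝ)) => {x : ℝ × ℂ × ℝ | (hermTwo x).PosDef}.indicator (fun x => cexp (-(hermTwo x * g).trace) * (hermTwo x).det ^ (s - 2)) ((ofLp y).1, ofLp (ofLp y).2)) (((1 / (2 * Real.pi) : ℝ)) • (toLp 2 ((c.1, (2 : ℝ) • c.2.1, c.2.2).1, toLp 2 (c.1, (2 : ℝ) • c.2.1, c.2.2).2) : WithLp 2 (ℝ × WithLp 2 (ℂ × ℝ))))) := by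
    have heq : (fun c : ℝ × ℂ × ℝ => 𝓕 (fun y : WithLp 2 (ℝ × WithLp 2 (ℂ × ℝ)) => {x : ℝ × ℂ × ℝ | (hermTwo x).PosDef}.indicator (fun x => cexp (-(hermTwo x * g).trace) * (hermTwo x).det ^ (s - 2)) ((ofLp y).1, ofLp (ofLp y).2)) (((1 / (2 * Real.pi) : ℝ)) • (toLp 2 ((c.1, (2 : ℝ) • c.2.1, c.2.2).1, toLp 2 (c.1, (2 : ℝ) • c.2.1, c.2.2).2) : WithLp 2 (ℝ × WithLp 2 (ℂ × ℝ))))) = fun c => hermTwoGamma s * (g + I • hermTwo c).det ^ (-s) :=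
      funext fun c => fourier_kernel_at hg hs1 c
    rw [heq]
    exact integrable_hermTwoGamma_mul_det_cpow hg hs
  have h2 : Integrable (fun c : ℝ × ℂ × ℝ => 𝓕 (fun y : WithLp 2 (ℝ × WithLp 2 (ℂ × ℝ)) => {x : ℝ × ℂ × ℝ | (hermTwo x).PosDef}.indicator (fun x => cexp (-(hermTwo x * g).trace) * (hermTwo x).det ^ (s - 2)) ((ofLp y).1, ofLp (ofLp y).2)) (((1 / (2 * Real.pi) : ℝ)) • (toLp 2 (c.1, toLp 2 c.2) : WithLp 2 (ℝ × WithLp 2 (ℂ × ℝ))))) := by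
    refine (integrable_comp_dblZ_iff (fun c : ℝ × ℂ × ℝ => 𝓕 (fun y : WithLp 2 (ℝ × WithLp 2 (ℂ × ℝ)) => {x : ℝ × ℂ × ℝ | (hermTwo x).PosDef}.indicator (fun x => cexp (-(hermTwo x * g).trace) * (hermTwo x).det ^ (s - 2)) ((ofLp y).1, ofLp (ofLp y).2)) (((1 / (2 * Real.pi) : ℝ)) • (toLp 2 (c.1, toLp 2 c.2) : WithLp 2 (ℝ × WithLp 2 (ℂ × ℝ))))) ?_).mp h3
    exact (hHc.measurable.comp (hιm.const_smul (1 / (2 * Real.pi)))).aestronglyMeasurable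
  have h1 : Integrable (fun y : WithLp 2 (ℝ × WithLp 2 (ℂ × ℝ)) => 𝓕 (fun y : WithLp 2 (ℝ × WithLp 2 (ℂ × ℝ)) => {x : ℝ × ℂ × ℝ | (hermTwo x).PosDef}.indicator (fun x => cexp (-(hermTwo x * g).trace) * (hermTwo x).det ^ (s - 2)) ((ofLp y).1, ofLp (ofLp y).2)) (((1 / (2 * Real.pi) : ℝ)) • y)) :=
    (integrable_comp_toLp2_iff (fun y : WithLp 2 (ℝ × WithLp 2 (ℂ × ℝ)) => 𝓕 (fun y : WithLp 2 (ℝ × WithLp 2 (ℂ × ℝ)) => {x : ℝ × ℂ × ℝ | (hermTwo x).PosDef}.indicator (fun x => cexp (-(hermTwo x * g).trace) * (hermTwo x).det ^ (s - 2)) ((ofLp y).1, ofLp (ofLp y).2)) (((1 / (2 * Real.pi) : ℝ)) • y))).mp h2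
  exact (integrable_comp_smul_iff volume _ hπ).mp h1

/-! ## Fourier inversion of the kernel -/

set_option maxHeartbeats 400000 in
-- see above
/-- The changed-variables integrand: `e^{−2πi⟪(2π)⁻¹ ι(dbl c), ι w⟫} 𝓕⁻f̃((2π)⁻¹ ι(dbl c)) = e^{−iτ(w,c)} Γ₂(s) det(g − ix_c)^{−s}`. -/
theorem cov_integrand_eq {g : Matrix (Fin 2) (Fin 2) ℂ} (hg : g.PosDef) {s : ℂ} (hs : 1 < s.re) (w c : ℝ × ℂ × ℝ) :
    cexp (↑(-2 * Real.pi * ⟪((1 / (2 * Real.pi) : ℝ)) • (toLp 2 ((c.1, (2 : ℝ) • c.2.1, c.2.2).1, toLp 2 (c.1, (2 : ℝ) • c.2.1, c.2.2).2) : WithLp 2 (ℝ × WithLp 2 (ℂ × ℝ))), (toLp 2 (w.1, toLp 2 w.2) : WithLp 2 (ℝ × WithLp 2 (ℂ × ℝ)))⟫) * I) •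
        𝓕⁻ (fun y : WithLp 2 (ℝ × WithLp 2 (ℂ × ℝ)) => {x : ℝ × ℂ × ℝ | (hermTwo x).PosDef}.indicator (fun x => cexp (-(hermTwo x * g).trace) * (hermTwo x).det ^ (s - 2)) ((ofLp y).1, ofLp (ofLp y).2)) (((1 / (2 * Real.pi) : ℝ)) • (toLp 2 ((c.1, (2 : ℝ) • c.2.1, c.2.2).1, toLp 2 (c.1, (2 : ℝ) • c.2.1, c.2.2).2) : WithLp 2 (ℝ × WithLp 2 (ℂ × ℝ)))) =
      cexp (-(I * (hermTwo w * hermTwo c).trace)) * (hermTwoGamma s * (g - I • hermTwo c).det ^ (-s)) := by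
  rw [fourierInv_kernel_at hg hs c, real_inner_smul_left, real_inner_comm, inner_toLp2_dbl w c, smul_eq_mul,
    trace_hermTwo_mul_hermTwo w c]
  have hπ0 : (Real.pi : ℂ) ≠ 0 := ofReal_ne_zero.mpr Real.pi_ne_zero
  congr 1
  congr 1
  push_cast
  field_simp

set_option maxHeartbeats 400000 in
-- see above
/-- **FOURIER INVERSION OF THE GAMMA KERNEL** (organ Φ6b-3, Y3a): for `g > 0`, `re s > 3` and `w` in the open cone,
`∫ e^{−iτ(w x)} · Γ₂(s) det(g − ix)^{−s} dx = 4π⁴ · e^{−τ(w g)} det(w)^{s−2}`. -/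
theorem integral_cexp_trace_mul_det_cpow {g : Matrix (Fin 2) (Fin 2) ℂ} (hg : g.PosDef) {s : ℂ} (hs : 3 < s.re)
    {w : ℝ × ℂ × ℝ} (hw : (hermTwo w).PosDef) :
    ∫ c : ℝ × ℂ × ℝ, cexp (-(I * (hermTwo w * hermTwo c).trace)) * (hermTwoGamma s * (g - I • hermTwo c).det ^ (-s)) =
      ((4 * Real.pi ^ 4 : ℝ) : ℂ) * (cexp (-(hermTwo w * g).trace) * (hermTwo w).det ^ (s - 2)) := by
  have hs1 : 1 < s.re := by linarith
  have hf := integrable_kernel_lp2 hg hs1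
  have hFf := integrable_fourier_kernel hg hs
  have hcont : ContinuousAt (fun y : WithLp 2 (ℝ × WithLp 2 (ℂ × ℝ)) => {x : ℝ × ℂ × ℝ | (hermTwo x).PosDef}.indicator (fun x => cexp (-(hermTwo x * g).trace) * (hermTwo x).det ^ (s - 2)) ((ofLp y).1, ofLp (ofLp y).2)) (toLp 2 (w.1, toLp 2 w.2) : WithLp 2 (ℝ × WithLp 2 (ℂ × ℝ))) := by
    have h1 : ContinuousAt (fun x : ℝ × ℂ × ℝ => {x : ℝ × ℂ × ℝ | (hermTwo x).PosDef}.indicator (fun x => cexp (-(hermTwo x * g).trace) * (hermTwo x).det ^ (s - 2)) x)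
        (((ofLp (toLp 2 (w.1, toLp 2 w.2) : WithLp 2 (ℝ × WithLp 2 (ℂ × ℝ)))).1,
          ofLp (ofLp (toLp 2 (w.1, toLp 2 w.2) : WithLp 2 (ℝ × WithLp 2 (ℂ × ℝ)))).2)) := by
      rw [ofLp2_toLp2]
      exact continuousAt_gammaKernel_of_posDef g s hw
    exact ContinuousAt.comp (f := fun y : WithLp 2 (ℝ × WithLp 2 (ℂ × ℝ)) => (((ofLp y).1, ofLp (ofLp y).2) : ℝ × ℂ × ℝ))
      h1 continuous_ofLp2.continuousAt
  have hinv := MeasureTheory.Integrable.fourier_fourierInv_eq hf hFf hcont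
  have hval : {x : ℝ × ℂ × ℝ | (hermTwo x).PosDef}.indicator (fun x => cexp (-(hermTwo x * g).trace) * (hermTwo x).det ^ (s - 2))
      (((ofLp (toLp 2 (w.1, toLp 2 w.2) : WithLp 2 (ℝ × WithLp 2 (ℂ × ℝ)))).1,
        ofLp (ofLp (toLp 2 (w.1, toLp 2 w.2) : WithLp 2 (ℝ × WithLp 2 (ℂ × ℝ)))).2)) =
      cexp (-(hermTwo w * g).trace) * (hermTwo w).det ^ (s - 2) := by
    rw [ofLp2_toLp2]
    exact gammaKernel_eq_of_posDef g s hw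
  -- measurability of the changed-variables integrand
  have hKc : Continuous (fun y : WithLp 2 (ℝ × WithLp 2 (ℂ × ℝ)) =>
      cexp (↑(-2 * Real.pi * ⟪y, (toLp 2 (w.1, toLp 2 w.2) : WithLp 2 (ℝ × WithLp 2 (ℂ × ℝ)))⟫) * I) • 𝓕⁻ (fun y : WithLp 2 (ℝ × WithLp 2 (ℂ × ℝ)) => {x : ℝ × ℂ × ℝ | (hermTwo x).PosDef}.indicator (fun x => cexp (-(hermTwo x * g).trace) * (hermTwo x).det ^ (s - 2)) ((ofLp y).1, ofLp (ofLp y).2)) y) := by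
    refine Continuous.smul (Complex.continuous_exp.comp ?_) (continuous_fourierInv_kernel hg hs1)
    exact (continuous_ofReal.comp (continuous_const.mul (continuous_id.inner continuous_const))).mul continuous_const
  have hιm : Measurable (fun c : ℝ × ℂ × ℝ => (toLp 2 (c.1, toLp 2 c.2) : WithLp 2 (ℝ × WithLp 2 (ℂ × ℝ)))) := measurableEmbedding_toLp2.measurable
  -- the three changes of variables
  have hA := integral_comp_smul_lp2 (fun y : WithLp 2 (ℝ × WithLp 2 (ℂ × ℝ)) =>
      cexp (↑(-2 * Real.pi * ⟪y, (toLp 2 (w.1, toLp 2 w.2) : WithLp 2 (ℝ × WithLp 2 (ℂ × ℝ)))⟫) * I) • 𝓕⁻ (fun y : WithLp 2 (ℝ × WithLp 2 (ℂ × ℝ)) => {x : ℝ × ℂ × ℝ | (hermTwo x).PosDef}.indicator (fun x => cexp (-(hermTwo x * g).trace) * (hermTwo x).det ^ (s - 2)) ((ofLp y).1, ofLp (ofLp y).2)) y) (1 / (2 * Real.pi))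
  have hB := integral_comp_toLp2 (fun y : WithLp 2 (ℝ × WithLp 2 (ℂ × ℝ)) =>
      cexp (↑(-2 * Real.pi * ⟪((1 / (2 * Real.pi) : ℝ)) • y, (toLp 2 (w.1, toLp 2 w.2) : WithLp 2 (ℝ × WithLp 2 (ℂ × ℝ)))⟫) * I) • 𝓕⁻ (fun y : WithLp 2 (ℝ × WithLp 2 (ℂ × ℝ)) => {x : ℝ × ℂ × ℝ | (hermTwo x).PosDef}.indicator (fun x => cexp (-(hermTwo x * g).trace) * (hermTwo x).det ^ (s - 2)) ((ofLp y).1, ofLp (ofLp y).2)) (((1 / (2 * Real.pi) : ℝ)) • y))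
  have hC := integral_comp_dblZ (fun c : ℝ × ℂ × ℝ =>
      cexp (↑(-2 * Real.pi * ⟪((1 / (2 * Real.pi) : ℝ)) • (toLp 2 (c.1, toLp 2 c.2) : WithLp 2 (ℝ × WithLp 2 (ℂ × ℝ))), (toLp 2 (w.1, toLp 2 w.2) : WithLp 2 (ℝ × WithLp 2 (ℂ × ℝ)))⟫) * I) •
        𝓕⁻ (fun y : WithLp 2 (ℝ × WithLp 2 (ℂ × ℝ)) => {x : ℝ × ℂ × ℝ | (hermTwo x).PosDef}.indicator (fun x => cexp (-(hermTwo x * g).trace) * (hermTwo x).det ^ (s - 2)) ((ofLp y).1, ofLp (ofLp y).2)) (((1 / (2 * Real.pi) : ℝ)) • (toLp 2 (c.1, toLp 2 c.2) : WithLp 2 (ℝ × WithLp 2 (ℂ × ℝ)))))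
    ((hKc.measurable.comp (hιm.const_smul (1 / (2 * Real.pi)))).aestronglyMeasurable)
  -- assemble: `∫ (target) = ¼ ∫_V₀ … = ¼ ∫_W …(R • y) = ¼ |R⁴|⁻¹ ∫_W K = ¼ (2π)⁴ 𝓕(𝓕⁻ f̃)(ι w)`
  have hchain : ∫ c : ℝ × ℂ × ℝ, cexp (-(I * (hermTwo w * hermTwo c).trace)) * (hermTwoGamma s * (g - I • hermTwo c).det ^ (-s)) =
      (4⁻¹ : ℝ) • (|((1 / (2 * Real.pi)) ^ 4)⁻¹| • (cexp (-(hermTwo w * g).trace) * (hermTwo w).det ^ (s - 2))) := by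
    rw [← hval, ← hinv, Real.fourier_eq', ← hA, ← hB, ← hC]
    exact integral_congr_ae (Filter.Eventually.of_forall fun c => (cov_integrand_eq hg hs1 w c).symm)
  rw [hchain]
  have hπ4 : |((1 / (2 * Real.pi)) ^ 4)⁻¹| = 16 * Real.pi ^ 4 := by
    rw [abs_of_pos (by positivity)]
    field_simp
    ring
  rw [hπ4, smul_smul, Complex.real_smul]
  congr 1
  push_cast
  ring

end Summit.HodgeConjecture.HodgeConjecture.Cruxes.HLiu418.K2LiuHermTwoGammaKernelInversion

end
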